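import Mathlib
import Literature.Combinatorics.SimpleGraph.LovaszTheta
import Literature.Computability.Complexity.ExtMonotoneGates
import Summits.PneNP.PneNP.Theses.ConvexRankGates

/-!
# Route ConvexRankGates — support item `ThetaGateKillsRazborovPair` (stmt-PneNP-10684)

`Summit.PneNP.PneNP.Theses.ConvexRankGates.ThetaGateKillsRazborovPair`: for `2 ≤ k ≤ m` ONE
monotone SDP-feasibility gate (a CONV gate, `IsConvGate`, of description `p + q ≤ 4m² + 4`)
reading the edge indicators of `K_m` accepts the clique vector of every `k`-set `S` and rejects
the colouring vector of every `h : Fin m → Fin (k - 1)` — Razborov's classical pair of test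
distributions for `CLIQUE` is separated by a single wide convex gate, which is why the route
abandons it.

The gate is the Lovász theta programme in feasibility form (Lovász 1979; Jukna 2012, Lemma 9.27;
Tardos 1988): `∃ Y ⪰ 0 (m × m) : tr Y ≤ 1, -tr Y ≤ -1, -⟨J, Y⟩ ≤ -k, ± Y_ab ≤ [x_ab] (a ≠ b)`,
i.e. `q = m` and `p = 3 + 2m²` constraints (the diagonal pairs carry the vacuous constraint
`0 ≤ …`).
* cliques: `Y = k⁻¹ 𝟙_S 𝟙_Sᵀ` is feasible (`isThetaFeasible_cliqueMatrix` of
  `Literature/Combinatorics/SimpleGraph/LovaszTheta.lean`, entries `k⁻¹ ≤ 1`);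
* colourings: a feasible `Y` vanishes off the diagonal inside every colour class, so it is
  theta-feasible for the complement of the complete `(k-1)`-partite graph of `h`, whence
  `k ≤ ⟨J, Y⟩ ≤ ϑ ≤ k - 1` (`lovaszTheta_compl_le_of_coloring`), a contradiction.
-/

namespace Summit.PneNP.PneNP.Theorems

open Literature.Computability.Complexity Literature.Combinatorics.SimpleGraph Matrix Finset

/-- A single gate `⟨k, f⟩` wired to the input variables `w` is a circuit of size `1` over any
basis containing the gate, computing `x ↦ f (x ∘ w)`. [folklore] -/
theorem exists_oneGate_circuit {ι : Type*} (k : ℕ) (f : (Fin k → Bool) → Bool) (w : Fin k → ι) :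
    ∃ C : Circuit ι, (∀ B : Set GateFn, (⟨k, f⟩ : GateFn) ∈ B → C.IsOver B) ∧ C.size = 1 ∧
      ∀ x, C.eval x = f (fun a => x (w a)) := by
  refine ⟨⟨[⟨k, f, fun a => .inl (w a)⟩], .inr 0, ?_, ?_⟩, ?_, rfl, fun x => rfl⟩
  · intro j hj a m hm
    have hj0 : j = 0 := by simpa using hj
    subst hj0
    simp at hm
  · rintro m ⟨⟩
    simp
  · intro B hB g hg
    simp only [List.mem_singleton] at hg
    subst hg
    exact hB

/-- The right-hand side of an edge constraint: summing the indicator of "input `j` is the edge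
`{a, c}`" against the input indicators returns the indicator of the edge variable `x_{ac}`.
[folklore] -/
theorem sum_edge_indicator {m n : ℕ} (eE : (⊤ : SimpleGraph (Fin m)).edgeSet ≃ Fin n)
    (x : (⊤ : SimpleGraph (Fin m)).edgeSet → Bool) {a c : Fin m} (hac : a ≠ c) :
    (∑ j : Fin n, (if ((eE.symm j : (⊤ : SimpleGraph (Fin m)).edgeSet) : Sym2 (Fin m)) = s(a, c)
        then (1 : ℝ) else 0) * (if x (eE.symm j) then (1 : ℝ) else 0)) =
      if x ⟨s(a, c), (SimpleGraph.mem_edgeSet ⊤).2 ((SimpleGraph.top_adj a c).2 hac)⟩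
        then (1 : ℝ) else 0 := by
  rw [Fintype.sum_equiv eE.symm _ (fun e : (⊤ : SimpleGraph (Fin m)).edgeSet =>
    (if (e : Sym2 (Fin m)) = s(a, c) then (1 : ℝ) else 0) * (if x e then (1 : ℝ) else 0))
    (fun _ => rfl)]
  rw [Finset.sum_eq_single ⟨s(a, c), (SimpleGraph.mem_edgeSet ⊤).2 ((SimpleGraph.top_adj a c).2 hac)⟩]
  · rw [if_pos rfl, one_mul]
  · intro e _ hne
    rw [if_neg (fun h => hne (Subtype.ext h)), zero_mul]
  · intro h
    exact absurd (Finset.mem_univ _) h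

/-- Every term of an edge-constraint right-hand side is nonnegative. [folklore] -/
theorem sum_edge_indicator_nonneg {m n : ℕ} (eE : (⊤ : SimpleGraph (Fin m)).edgeSet ≃ Fin n)
    (x : (⊤ : SimpleGraph (Fin m)).edgeSet → Bool) (e₀ : Sym2 (Fin m)) :
    0 ≤ ∑ j : Fin n, (if ((eE.symm j : (⊤ : SimpleGraph (Fin m)).edgeSet) : Sym2 (Fin m)) = e₀
        then (1 : ℝ) else 0) * (if x (eE.symm j) then (1 : ℝ) else 0) :=
  Finset.sum_nonneg fun j _ => mul_nonneg (by split_ifs <;> norm_num) (by split_ifs <;> norm_num)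

/-- **Colouring half, matrix form** (Lovász 1979; Jukna 2012, Lemma 9.27): a positive
semidefinite `Y` of trace `1` vanishing off the diagonal inside every class of
`h : Fin m → Fin c` has `⟨J, Y⟩ = Σ_{u,v} Y_{uv} ≤ c` — it is theta-feasible for the complement
of the complete multipartite graph of `h`, which `h` properly colours.
[cite: Jukna2012, Lemma 9.27 (PDF p. 286)] -/
theorem entrySum_le_of_classes {m c : ℕ} (h : Fin m → Fin c) {Y : Matrix (Fin m) (Fin m) ℝ}
    (hpsd : Y.PosSemidef) (htr : Y.trace = 1)
    (h0 : ∀ u v : Fin m, u ≠ v → h u = h v → Y u v = 0) : entrySum Y ≤ c := by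
  classical
  let G : SimpleGraph (Fin m) := (⊤ : SimpleGraph (Fin c)).comap h
  have hfeas : IsThetaFeasible Gᶜ Y := ⟨hpsd, htr, fun u v huv => by
    rw [SimpleGraph.compl_adj] at huv
    refine h0 u v huv.1 ?_
    have h2 := huv.2
    simp only [G, SimpleGraph.comap_adj, SimpleGraph.top_adj, ne_eq, not_not] at h2
    exact h2⟩
  let col : G.Coloring (Fin c) := SimpleGraph.Coloring.mk h fun huv =>
    (SimpleGraph.top_adj _ _).1 (SimpleGraph.comap_adj.1 huv)
  calc entrySum Y ≤ lovaszTheta Gᶜ := le_csSup (bddAbove_thetaValues _) ⟨Y, hfeas, rfl⟩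
    _ ≤ c := lovaszTheta_compl_le_of_coloring col

/-- **`ThetaGateKillsRazborovPair`** (route ConvexRankGates, stmt-PneNP-10684): for `2 ≤ k ≤ m`
one CONV gate of description `≤ 4m² + 4` — the Lovász theta programme in feasibility form,
`∃ Y ⪰ 0 : tr Y = 1, ⟨J, Y⟩ ≥ k, |Y_ab| ≤ [x_ab] (a ≠ b)` — accepts every `k`-clique vector and
rejects every complete `(k-1)`-partite (colouring) vector (Lovász 1979 sandwich
`ω ≤ ϑ(Ḡ) ≤ χ`; Jukna 2012, Lemma 9.27; Tardos 1988). [cite: Jukna2012, Lemma 9.27 (PDF p. 286)] -/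
theorem thetaGateKillsRazborovPair_proof :
    Summit.PneNP.PneNP.Theses.ConvexRankGates.ThetaGateKillsRazborovPair := by
  unfold Summit.PneNP.PneNP.Theses.ConvexRankGates.ThetaGateKillsRazborovPair
  dsimp only
  intro m k hk hkm
  classical
  -- enumerations of the edge variables and of the constraints
  let n : ℕ := Fintype.card (⊤ : SimpleGraph (Fin m)).edgeSet
  let eE : (⊤ : SimpleGraph (Fin m)).edgeSet ≃ Fin n := Fintype.equivFin _
  let I : Type := Unit ⊕ Unit ⊕ Unit ⊕ (Fin m × Fin m × Bool)
  let p : ℕ := Fintype.card I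
  let eI : I ≃ Fin p := Fintype.equivFin I
  -- the data of the theta programme
  let J : Matrix (Fin m) (Fin m) ℝ := Matrix.of fun _ _ => 1
  let A' : I → Matrix (Fin m) (Fin m) ℝ := Sum.elim (fun _ => 1) (Sum.elim (fun _ => -1)
    (Sum.elim (fun _ => -J) (fun t => Matrix.single t.2.1 t.1
      (if t.1 = t.2.1 then 0 else if t.2.2 then 1 else -1))))
  let b' : I → ℝ := Sum.elim (fun _ => 1) (Sum.elim (fun _ => -1)
    (Sum.elim (fun _ => -(k : ℝ)) (fun _ => 0)))
  let B' : I → Fin n → ℝ := Sum.elim (fun _ _ => 0) (Sum.elim (fun _ _ => 0)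
    (Sum.elim (fun _ _ => 0) (fun t j =>
      if ((eE.symm j : (⊤ : SimpleGraph (Fin m)).edgeSet) : Sym2 (Fin m)) = s(t.1, t.2.1)
        then 1 else 0)))
  let A : Fin p → Matrix (Fin m) (Fin m) ℝ := fun i => A' (eI.symm i)
  let b : Fin p → ℝ := fun i => b' (eI.symm i)
  let B : Fin p → Fin n → ℝ := fun i j => B' (eI.symm i) j
  let Feas : (Fin n → Bool) → Prop := fun v => ∃ Y : Matrix (Fin m) (Fin m) ℝ, Y.PosSemidef ∧
    ∀ i, (A i * Y).trace ≤ b i + ∑ j, B i j * (if v j then (1 : ℝ) else 0)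
  obtain ⟨C, hCover, hCsize, hCeval⟩ :=
    exists_oneGate_circuit n (fun v => decide (Feas v)) (fun a => eE.symm a)
  -- ⟨J, Y⟩ as a trace
  have hJ : ∀ Y : Matrix (Fin m) (Fin m) ℝ, (J * Y).trace = entrySum Y := fun Y => by
    simp only [Matrix.trace, Matrix.diag, Matrix.mul_apply, J, Matrix.of_apply, one_mul, entrySum]
    exact Finset.sum_comm
  have hk0 : (k : ℝ) ≠ 0 := by exact_mod_cast (show k ≠ 0 by omega)
  have hk1 : (1 : ℝ) ≤ k := by exact_mod_cast (show 1 ≤ k by omega)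
  refine ⟨C, hCover _ ?_, hCsize, ?_, ?_⟩
  · -- the gate is a CONV gate of description `p + m ≤ 4 m² + 4`
    refine ⟨p, m, ?_, A, b, B, ?_, fun v => decide_eq_true_iff⟩
    · have hp : p = 1 + (1 + (1 + m * (m * 2))) := by
        simp [p, I, Fintype.card_sum, Fintype.card_prod, Fintype.card_bool, Fintype.card_unique]
      rw [hp]
      nlinarith [Nat.le_mul_self m]
    · intro i j
      simp only [B, B']
      rcases eI.symm i with _ | _ | _ | t
      · simp
      · simp
      · simp
      · simp only [Sum.elim_inr]
        split_ifs <;> norm_num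
  · -- clique vectors are accepted: `Y = k⁻¹ 𝟙_S 𝟙_Sᵀ`
    intro S hS
    rw [hCeval, decide_eq_true_iff]
    have hclique : (⊤ : SimpleGraph (Fin m)).IsNClique k S :=
      ⟨fun a _ c _ hac => (SimpleGraph.top_adj a c).2 hac, hS⟩
    obtain ⟨hfeas, hval⟩ := isThetaFeasible_cliqueMatrix hclique (by omega)
    refine ⟨(k : ℝ)⁻¹ • vecMulVec (indVec S) (indVec S), hfeas.posSemidef, fun i => ?_⟩
    have hentry : ∀ a c : Fin m, ((k : ℝ)⁻¹ • vecMulVec (indVec S) (indVec S)) a c =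
        if a ∈ S ∧ c ∈ S then (k : ℝ)⁻¹ else 0 := fun a c => by
      simp only [Matrix.smul_apply, vecMulVec_apply, indVec, smul_eq_mul, mul_ite, mul_one,
        mul_zero]
      by_cases ha : a ∈ S <;> by_cases hc : c ∈ S <;> simp [ha, hc]
    obtain ⟨o, rfl⟩ := eI.surjective i
    simp only [A, b, B, A', b', B', Equiv.symm_apply_apply]
    rcases o with _ | _ | _ | ⟨a, c, sgn⟩
    · -- `tr Y ≤ 1`
      simp only [Sum.elim_inl, Matrix.one_mul, zero_mul, Finset.sum_const_zero, add_zero]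
      exact hfeas.trace_eq_one.le
    · -- `-tr Y ≤ -1`
      simp only [Sum.elim_inl, Sum.elim_inr, Matrix.neg_mul, Matrix.one_mul, Matrix.trace_neg,
        zero_mul, Finset.sum_const_zero, add_zero]
      exact neg_le_neg hfeas.trace_eq_one.ge
    · -- `-⟨J, Y⟩ ≤ -k`
      simp only [Sum.elim_inl, Sum.elim_inr, Matrix.neg_mul, Matrix.trace_neg, zero_mul,
        Finset.sum_const_zero, add_zero]
      rw [hJ, hval]
    · -- `± Y_ac ≤ [x_ac]`
      simp only [Sum.elim_inr, Matrix.trace_single_mul, smul_eq_mul, zero_add]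
      by_cases hac : a = c
      · rw [if_pos hac, zero_mul]
        exact sum_edge_indicator_nonneg eE (fun e => decide (∀ v ∈ (e : Sym2 (Fin m)), v ∈ S)) _
      · rw [if_neg hac, sum_edge_indicator eE (fun e => decide (∀ v ∈ (e : Sym2 (Fin m)), v ∈ S))
          hac, hentry]
        simp only [decide_eq_true_eq, Sym2.mem_iff, forall_eq_or_imp, forall_eq]
        have hkinv : (0 : ℝ) ≤ (k : ℝ)⁻¹ := by positivity
        have hkinv1 : (k : ℝ)⁻¹ ≤ 1 := inv_le_one_of_one_le₀ hk1
        by_cases hS2 : a ∈ S ∧ c ∈ S <;> cases sgn <;> simp [hS2] <;> linarith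
  · -- colouring vectors are rejected
    intro h
    rw [hCeval, decide_eq_false_iff_not]
    rintro ⟨Y, hY, hc⟩
    have hcon : ∀ o : I, (A' o * Y).trace ≤ b' o + ∑ j, B' o j *
        (if !decide (Sym2.IsDiag (Sym2.map h ↑(eE.symm j))) then (1 : ℝ) else 0) := fun o => by
      have := hc (eI o)
      simp only [A, b, B, Equiv.symm_apply_apply] at this
      exact this
    -- `tr Y = 1`
    have htr : Y.trace = 1 := by
      have h1 := hcon (Sum.inl ())
      have h2 := hcon (Sum.inr (Sum.inl ()))
      simp only [A', b', B', Sum.elim_inl, Sum.elim_inr, Matrix.one_mul, Matrix.neg_mul,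
        Matrix.trace_neg, zero_mul, Finset.sum_const_zero, add_zero] at h1 h2
      linarith
    -- `k ≤ ⟨J, Y⟩`
    have hsum : (k : ℝ) ≤ entrySum Y := by
      have h3 := hcon (Sum.inr (Sum.inr (Sum.inl ())))
      simp only [A', b', B', Sum.elim_inl, Sum.elim_inr, Matrix.neg_mul, Matrix.trace_neg,
        zero_mul, Finset.sum_const_zero, add_zero] at h3
      rw [hJ] at h3
      linarith
    -- `Y` vanishes off the diagonal inside colour classes
    have h0 : ∀ u v : Fin m, u ≠ v → h u = h v → Y u v = 0 := by
      intro u v huv hhuv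
      have h4 := hcon (Sum.inr (Sum.inr (Sum.inr (u, v, true))))
      have h5 := hcon (Sum.inr (Sum.inr (Sum.inr (u, v, false))))
      simp only [A', b', B', Sum.elim_inr, Matrix.trace_single_mul, smul_eq_mul, zero_add,
        if_neg huv, if_true] at h4 h5
      rw [sum_edge_indicator eE (fun e => !decide ((Sym2.map h (e : Sym2 (Fin m))).IsDiag)) huv]
        at h4 h5
      simp only [Sym2.map_mk, Sym2.mk_isDiag_iff, hhuv, decide_true, Bool.not_true,
        Bool.false_eq_true, if_false] at h4 h5
      norm_num at h4 h5
      linarith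
    have hle := entrySum_le_of_classes h hY htr h0
    have hcast : ((k - 1 : ℕ) : ℝ) = (k : ℝ) - 1 := by
      rw [Nat.cast_sub (by omega), Nat.cast_one]
    rw [hcast] at hle
    linarith

end Summit.PneNP.PneNP.Theorems
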